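import Summits.AnomalousDissipation.AnomalousDissipation.Theorems.DriftStatesAreLerayHopf.Negative.DriftModeSteady
import Literature.Analysis.FunctionSpaces.TorusFourierCalculus

/-!
# Dissipation of the drifted single Stokes modes (clause 3 of the aside
`SymmetricOrLoud.DriftStatesAreLerayHopf`)

Negative-lane file (small-model facts; no Theses statement is asserted). For the steady drifted
mode `d = W + a sin(2πk·x)v + b cos(2πk·x)v` (`k ≠ 0`):
`∂ⱼ d = 2πkⱼ (a cos − b sin)(2πk·x) v` (`partialDeriv_driftMode`), `‖∇d‖₂² = λ · ½‖v‖²(a² + b²)`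
with `λ = 4π²|k|²` (`gradNormSq_driftMode`), hence `⟨ν‖∇d‖²⟩ = νλ · ½‖v‖²(a² + b²)`
(`meanDissipation_driftMode`). For the Kolmogorov drift states of item 28615 (`λ = 16π²`,
`a² + b² = 1/(16π²(V² + 16π²ν²))`) this is `ν/(2(V² + 16π²ν²))` — clause 3 verbatim
(`meanDissipation_kolmogorovDrift`): dissipation `O(ν)` (QUIET) at bounded energy
`→ V² + 1/(32π²V²)` for `V ≠ 0`. With `DriftModeSteady` all three clauses of the aside are in the
tree as separate theorems; the item (their conjunction) is left to a prover.
-/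

noncomputable section
-- the mandated namespace `Summit.<Summit>.<Problem>.Theorems` repeats `AnomalousDissipation` (single-problem summit)
set_option linter.dupNamespace false

namespace Summit.AnomalousDissipation.AnomalousDissipation.Theorems.DriftStatesAreLerayHopf.Negative

open MeasureTheory Set Filter Topology UnitAddTorus
open scoped ENNReal NNReal InnerProductSpace ContDiff
open Literature.Analysis.FunctionSpaces Literature.Analysis.FunctionSpaces.Torus
open Literature.Analysis.FluidPDE Literature.Analysis.FluidPDE.Torus

variable {k : Fin 3 → ℤ} {v : EuclideanSpace ℝ (Fin 3)}

/-! ## 1. Partial derivatives of constant fields and single modes -/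

/-- `∂ⱼ W = 0` for a constant field. [folklore] -/
theorem partialDeriv_constField (j : Fin 3) (W : EuclideanSpace ℝ (Fin 3)) (x : UnitAddTorus (Fin 3)) :
    partialDeriv j (fun _ : UnitAddTorus (Fin 3) => W) x = 0 := by
  unfold Torus.partialDeriv Torus.lineDeriv
  simp

/-- `∂ⱼ (sin(2πk·x) v) = 2πkⱼ cos(2πk·x) v`. [folklore] -/
theorem partialDeriv_stokesMode_false (k : Fin 3 → ℤ) (v : EuclideanSpace ℝ (Fin 3)) (j : Fin 3)
    (x : UnitAddTorus (Fin 3)) :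
    partialDeriv j ⇑(stokesMode k v false) x = (2 * Real.pi * (k j : ℝ)) • stokesMode k v true x := by
  rw [stokesMode_eq_realTrigPoly, partialDeriv_realTrigPoly, realTrigPoly_singleton_apply,
    stokesMode_eq_realTrigPoly, realTrigPoly_singleton_apply]
  ext i
  simp [EuclideanSpace.realPart_apply, EuclideanSpace.complexify_apply, Complex.mul_re, Complex.mul_im]
  ring

/-- `∂ⱼ (cos(2πk·x) v) = −2πkⱼ sin(2πk·x) v`. [folklore] -/
theorem partialDeriv_stokesMode_true (k : Fin 3 → ℤ) (v : EuclideanSpace ℝ (Fin 3)) (j : Fin 3)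
    (x : UnitAddTorus (Fin 3)) :
    partialDeriv j ⇑(stokesMode k v true) x = (-(2 * Real.pi * (k j : ℝ))) • stokesMode k v false x := by
  rw [stokesMode_eq_realTrigPoly, partialDeriv_realTrigPoly, realTrigPoly_singleton_apply,
    stokesMode_eq_realTrigPoly, realTrigPoly_singleton_apply]
  ext i
  simp [EuclideanSpace.realPart_apply, EuclideanSpace.complexify_apply, Complex.mul_re, Complex.mul_im]
  ring

/-- **Gradient of a drifted mode**: `∂ⱼ d = 2πkⱼ (a cos(2πk·x) v − b sin(2πk·x) v)`. [folklore] -/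
theorem partialDeriv_driftMode (k : Fin 3 → ℤ) (v W : EuclideanSpace ℝ (Fin 3)) (a b : ℝ) (j : Fin 3)
    (x : UnitAddTorus (Fin 3)) :
    partialDeriv j (fun y : UnitAddTorus (Fin 3) => W + a • stokesMode k v false y + b • stokesMode k v true y) x =
      (2 * Real.pi * (k j : ℝ)) • ((0 : EuclideanSpace ℝ (Fin 3)) + (-b) • stokesMode k v false x +
        a • stokesMode k v true x) := by
  have h : (fun y : UnitAddTorus (Fin 3) => W + a • stokesMode k v false y + b • stokesMode k v true y) =
      (fun _ => W) + a • ⇑(stokesMode k v false) + b • ⇑(stokesMode k v true) := by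
    funext y; simp
  have hW : IsContDiff 1 (fun _ : UnitAddTorus (Fin 3) => W) := (isSmooth_const W).isContDiff (by simp)
  have hS : IsContDiff 1 ⇑(stokesMode k v false) := (isSmooth_stokesMode k v false).isContDiff (by simp)
  have hC : IsContDiff 1 ⇑(stokesMode k v true) := (isSmooth_stokesMode k v true).isContDiff (by simp)
  rw [h, partialDeriv_add (hW.add (hS.smul a)) (hC.smul b), partialDeriv_add hW (hS.smul a),
    partialDeriv_const_smul hS, partialDeriv_const_smul hC]
  simp only [Pi.add_apply, Pi.smul_apply]
  rw [partialDeriv_constField, partialDeriv_stokesMode_false, partialDeriv_stokesMode_true]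
  module

/-! ## 2. Gradient norm and mean dissipation -/

/-- `∑ⱼ (2πkⱼ)² = λ_k = 4π²|k|²`. [folklore] -/
theorem sum_sq_two_pi_mul (k : Fin 3 → ℤ) :
    ∑ j : Fin 3, (2 * Real.pi * (k j : ℝ)) ^ 2 = stokesEigenvalue k := by
  unfold stokesEigenvalue freqNormSq
  rw [Finset.mul_sum]
  refine Finset.sum_congr rfl fun j _ => ?_
  ring

/-- **`‖∇d‖₂² = λ · ½‖v‖²(a² + b²)`** for the drifted mode (`k ≠ 0`). [folklore] -/
theorem gradNormSq_driftMode (hk : k ≠ 0) (v W : EuclideanSpace ℝ (Fin 3)) (a b : ℝ) :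
    gradNormSq (fun y : UnitAddTorus (Fin 3) => W + a • stokesMode k v false y + b • stokesMode k v true y) =
      stokesEigenvalue k * (‖v‖ ^ 2 / 2 * (a ^ 2 + b ^ 2)) := by
  unfold gradNormSq
  simp_rw [partialDeriv_driftMode, norm_smul, mul_pow, Real.norm_eq_abs, sq_abs, ← Finset.sum_mul,
    sum_sq_two_pi_mul, integral_const_mul, integral_norm_sq_driftMode hk v 0 (-b) a]
  rw [norm_zero]
  ring

/-- **Mean dissipation of the steady drifted mode** `= νλ · ½‖v‖²(a² + b²)`. [folklore] -/
theorem meanDissipation_driftMode (hk : k ≠ 0) (v W : EuclideanSpace ℝ (Fin 3)) (a b ν : ℝ) :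
    meanDissipation ν (fun _ : ℝ => fun y : UnitAddTorus (Fin 3) =>
        W + a • stokesMode k v false y + b • stokesMode k v true y) =
      ν * (stokesEigenvalue k * (‖v‖ ^ 2 / 2 * (a ^ 2 + b ^ 2))) := by
  rw [meanDissipation_eq_of_periodic (τ := 1) (fun _ => rfl) one_pos,
    ← gradNormSq_eq_toReal_eGradNormSq_holds (isSmooth_driftMode k v W a b), gradNormSq_driftMode hk]
  simp

/-- **Mean dissipation of the Kolmogorov drift states** — clause 3 of
`SymmetricOrLoud.DriftStatesAreLerayHopf` verbatim: `ν/(2(V² + 16π²ν²))`. [folklore] -/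
theorem meanDissipation_kolmogorovDrift (V : ℝ) {ν : ℝ} (hν : 0 < ν) :
    meanDissipation ν (fun _ : ℝ => fun x : UnitAddTorus (Fin 3) => V • EuclideanSpace.single (1 : Fin 3) (1 : ℝ) +
        (ν / (V ^ 2 + 16 * Real.pi ^ 2 * ν ^ 2)) •
          (stokesMode (![0, 2, 0] : Fin 3 → ℤ) (EuclideanSpace.single (0 : Fin 3) (1 : ℝ)) false x) +
        (-V / (4 * Real.pi * (V ^ 2 + 16 * Real.pi ^ 2 * ν ^ 2))) •
          (stokesMode (![0, 2, 0] : Fin 3 → ℤ) (EuclideanSpace.single (0 : Fin 3) (1 : ℝ)) true x)) =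
      ν / (2 * (V ^ 2 + 16 * Real.pi ^ 2 * ν ^ 2)) := by
  have hk : (![0, 2, 0] : Fin 3 → ℤ) ≠ 0 := fun h => by simpa using congrFun h 1
  have hD : V ^ 2 + 16 * Real.pi ^ 2 * ν ^ 2 ≠ 0 := by positivity
  have hπ : Real.pi ≠ 0 := Real.pi_ne_zero
  rw [meanDissipation_driftMode hk, stokesEigenvalue_kolmogorov]
  simp
  field_simp
  ring

/-! ## 3. The three clauses together (generic drifted mode) -/

/-- **Steady drifted modes: Leray–Hopf, energy and dissipation in closed form** — the generic
statement behind the aside `DriftStatesAreLerayHopf`: for `k ≠ 0`, `⟪k, v⟫ = 0`, any drift `W`,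
amplitudes `a, b` and `ν`, the steady field `d = W + a sin v + b cos v` is a global Leray–Hopf
solution for the single-mode force `(νλa − 2πσb) sin v + (νλb + 2πσa) cos v` (`σ = ⟪k, W⟫`) with
`⟨‖d‖²⟩ = ‖W‖² + ½‖v‖²(a² + b²)` and `⟨ν‖∇d‖²⟩ = νλ · ½‖v‖²(a² + b²)`. [folklore] -/
theorem driftMode_lerayHopf_energy_dissipation (hk : k ≠ 0) (hkv : ⟪latticeVec k, v⟫_ℝ = 0)
    (W : EuclideanSpace ℝ (Fin 3)) (a b ν : ℝ) :
    IsGlobalLerayHopf ν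
        (fun _ (x : UnitAddTorus (Fin 3)) =>
          (ν * stokesEigenvalue k * a - 2 * Real.pi * ⟪latticeVec k, W⟫_ℝ * b) • stokesMode k v false x +
            (ν * stokesEigenvalue k * b + 2 * Real.pi * ⟪latticeVec k, W⟫_ℝ * a) • stokesMode k v true x)
        (fun x : UnitAddTorus (Fin 3) => W + a • stokesMode k v false x + b • stokesMode k v true x)
        (fun _ (x : UnitAddTorus (Fin 3)) => W + a • stokesMode k v false x + b • stokesMode k v true x) ∧
      meanEnergy (fun _ : ℝ => fun x : UnitAddTorus (Fin 3) =>
          W + a • stokesMode k v false x + b • stokesMode k v true x) = ‖W‖ ^ 2 + ‖v‖ ^ 2 / 2 * (a ^ 2 + b ^ 2) ∧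
      meanDissipation ν (fun _ : ℝ => fun x : UnitAddTorus (Fin 3) =>
          W + a • stokesMode k v false x + b • stokesMode k v true x) =
        ν * (stokesEigenvalue k * (‖v‖ ^ 2 / 2 * (a ^ 2 + b ^ 2))) :=
  ⟨isGlobalLerayHopf_driftMode hkv W a b ν, meanEnergy_driftMode hk v W a b, meanDissipation_driftMode hk v W a b ν⟩

end Summit.AnomalousDissipation.AnomalousDissipation.Theorems.DriftStatesAreLerayHopf.Negative

end
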